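import Literature.Analysis.Matrix.TraceInvMulMixedDifferenceLocalMaps
import Literature.Analysis.Matrix.LogDetMixedDifferenceExpLocalised
import HarnessLib

/-!
# `ΔΔ tr(K⁻¹H)` over a rectangle — THE STIFFNESS EDITION: the Combes–Thomas rows and the invertibility of the four Hessians DERIVED from
# range one, off-diagonal row∕column sums and a positive-definite gap (`coercive_combes_thomas_real` ∘ `sq_floor_of_quadratic_floor`)

Topic `Literature/Analysis/Matrix`; namespace `Literature.Analysis.Matrix`.  Sequel of `TraceInvMulMixedDifferenceLocalMaps.lean`
(`abs_fourPt_trace_inv_mul_le_of_localMaps`: the one-loop trace rectangle END TO END from two local maps and four localised configurations,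
with the Combes–Thomas profile `|K(U i j)⁻¹ a b| ≤ α·e^{−θ·dist a b}` and `det K(U i j) ≠ 0` as displayed ROWS) and of
`LogDetMixedDifferenceExpLocalised.lean` (`coercive_combes_thomas_real`, `sq_floor_of_quadratic_floor`).  Everything here is PROVED; no
definitions, no named facts.

THE POINT.  In print the decay of the propagator is not a hypothesis but a CONSEQUENCE of the structure of the Hessian at the background: finite
range, bounded couplings, and a positive lower bound of the quadratic form — the STIFFNESS of the action at the (constrained) minimiser
([Balaban1985Variational] (9)–(10) p. 279: positivity of the Hessian on the small-field domain; [Balaban1984PropagatorsII] (1.33): the resulting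
exponential decay).  The finite-dimensional form of that implication is the tree's Combes–Thomas theorem.  This file composes it with the
end-to-end rectangle, so that the displayed inputs of the one-loop trace bound read exactly «two local maps; four exponentially localised
configurations; at each of them the Hessian `K` has range one, off-diagonal absolute row∕column sums `≤ h` and gap `m` (`m·Σv² ≤ Σ v·(Kv)`);
a rate `θ` with `h·(e^θ − 1) ≤ m∕2`»:
* ★★`abs_fourPt_trace_inv_mul_le_of_floor` — `|ΔΔ tr(K(U)⁻¹H(U))| ≤ C(2∕m, …)·s·t·e^{−(θ−θ₂)·R}` with the constant of
  `abs_fourPt_trace_inv_mul_le_of_localMaps` at `α := 2∕m`, locality radius and range `1`; the four determinants are non-zero by the theorem,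
  not by hypothesis.

HONEST SCOPE: finite-dimensional linear algebra; the gap `m`, the sums `h`, the locality constants and the response rows of an actual lattice
Hessian∕background are hypotheses, and their uniformity in the size of the system is the consumer's analysis.  Consumer: cell `ym3-torus`, crux
`FluctuationComparisonRegPrIntL`, DISCHARGE-SPEC v1.8 §11 (xv).  Nothing here bears on the Yang–Mills mass gap (Clay), which is NOT proved.

References: T. Bałaban, CMP 102 (1985) 277, Thm 1 (9)–(10) p. 279 [Balaban1985Variational]; CMP 96 (1984) 223, (1.33) [Balaban1984PropagatorsII];
J.-M. Combes, L. Thomas, CMP 34 (1973) 251 [CombesThomas1973]; M. Aizenman, S. Warzel, *Random Operators* (2015) §10.3 [AizenmanWarzel2015].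
-/

noncomputable section

open Matrix Finset
open scoped Matrix

namespace Literature.Analysis.Matrix

variable {n : Type*} [Fintype n] [DecidableEq n]

/-- ★★ **THE ONE-LOOP TRACE RECTANGLE FROM STIFFNESS.**  As `abs_fourPt_trace_inv_mul_le_of_localMaps` (two maps `K, H` local of radius `1`
with first∕second-order constants, values of range `1`; four configurations `U₀₀ U₁₀ U₀₁ U₁₁` with the five localised displacement rows; ball
count `V`; 1-Lipschitz profiles `d, d′`; separations; local sums; `Σ|H U₀₀| ≤ η`), but with the inverses' rows REPLACED by: `dist` a pseudo-metric
(`dist i i = 0`, symmetric, triangle inequality); at each of the four corners `X` the matrix `K X` has off-diagonal absolute row and column sums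
`≤ h` and the QUADRATIC-FORM FLOOR `m·Σ (v i)² ≤ Σ v i·(K X v) i` (`m > 0`); and `h·(e^θ − 1) ≤ m∕2`.  Then the four `K X` are invertible
with `|(K X)⁻¹ a b| ≤ (2∕m)·e^{−θ·dist a b}` (`coercive_combes_thomas_real` ∘ `sq_floor_of_quadratic_floor`) and
`|tr((K U₁₁)⁻¹H U₁₁) − tr((K U₁₀)⁻¹H U₁₀) − tr((K U₀₁)⁻¹H U₀₁) + tr((K U₀₀)⁻¹H U₀₀)| ≤`
`((2∕m·(L_H·V·μ + L_H₂·V²·δ²) + (2∕m)²·η·(L_K·V·μ + L_K₂·V²·δ²))·e^{2θ}·V·S_loc + 2·(2∕m)²·S_loc·S_dist·L_K·(L_H + (2∕m)·η·L_K)·(V²·e^{2θ}·δ)²)·s·t·e^{−(θ−θ₂)·R}`.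
[cite: Balaban1985Variational, Thm 1 (9)–(10) p. 279] [cite: AizenmanWarzel2015, §10.3 (Combes–Thomas estimate)] -/
theorem abs_fourPt_trace_inv_mul_le_of_floor (dist : n → n → ℕ) (hd0 : ∀ i, dist i i = 0) (hds : ∀ a b, dist a b = dist b a)
    (hdt : ∀ i j k, dist i k ≤ dist i j + dist j k)
    {K H : (n → ℝ) → Matrix n n ℝ} {LK LK₂ LH LH₂ : ℝ}
    (hLK : 0 ≤ LK) (hLK₂ : 0 ≤ LK₂) (hLH : 0 ≤ LH) (hLH₂ : 0 ≤ LH₂)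
    (hKloc : ∀ U U' i j, |K U i j - K U' i j| ≤ LK * ∑ k ∈ univ.filter (fun k => dist i k ≤ 1), |U k - U' k|)
    (hKloc₂ : ∀ U a b i j, |K (U + a + b) i j - K (U + a) i j - K (U + b) i j + K U i j| ≤
      LK₂ * (∑ k ∈ univ.filter (fun k => dist i k ≤ 1), |a k|) * (∑ k ∈ univ.filter (fun k => dist i k ≤ 1), |b k|))
    (hHloc : ∀ U U' i j, |H U i j - H U' i j| ≤ LH * ∑ k ∈ univ.filter (fun k => dist i k ≤ 1), |U k - U' k|)
    (hHloc₂ : ∀ U a b i j, |H (U + a + b) i j - H (U + a) i j - H (U + b) i j + H U i j| ≤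
      LH₂ * (∑ k ∈ univ.filter (fun k => dist i k ≤ 1), |a k|) * (∑ k ∈ univ.filter (fun k => dist i k ≤ 1), |b k|))
    (hKr : ∀ U a b, K U a b ≠ 0 → dist a b ≤ 1) (hHr : ∀ U a b, H U a b ≠ 0 → dist a b ≤ 1)
    {V : ℕ} (hV : ∀ a, (univ.filter fun b => dist a b ≤ 1).card ≤ V)
    {θ θ₂ : ℝ} (hθ₂ : 0 ≤ θ₂) (hθ₂θ : θ₂ ≤ θ)
    {d d' : n → ℕ} (hd : ∀ i k, d i ≤ dist i k + d k) (hd' : ∀ i k, d' i ≤ dist i k + d' k)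
    {R : ℕ} (hsep : ∀ a b, R ≤ d a + dist a b + d' b) (hsep₂ : ∀ a, R ≤ d a + d' a)
    {Sloc Sdist : ℝ} (hSd : ∑ a, Real.exp (-(θ₂ * d a)) ≤ Sloc) (hSd' : ∑ a, Real.exp (-(θ₂ * d' a)) ≤ Sloc)
    (hSdi : ∀ a, ∑ b, Real.exp (-(θ₂ * dist a b)) ≤ Sdist) (hSdist0 : 0 ≤ Sdist)
    {U₀₀ U₁₀ U₀₁ U₁₁ : n → ℝ} {δ μ s t : ℝ} (hδ : 0 ≤ δ) (hμ : 0 ≤ μ) (hs : 0 ≤ s) (ht : 0 ≤ t)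
    (hD10 : ∀ k, |U₁₀ k - U₀₀ k| ≤ δ * s * Real.exp (-(θ * d k)))
    (hD11 : ∀ k, |U₁₁ k - U₀₁ k| ≤ δ * s * Real.exp (-(θ * d k)))
    (hD01 : ∀ k, |U₀₁ k - U₀₀ k| ≤ δ * t * Real.exp (-(θ * d' k)))
    (hD11' : ∀ k, |U₁₁ k - U₁₀ k| ≤ δ * t * Real.exp (-(θ * d' k)))
    (hDD : ∀ k, |U₁₁ k - U₁₀ k - U₀₁ k + U₀₀ k| ≤ μ * s * t * Real.exp (-(θ * (d k + d' k))))
    {h m : ℝ} (hm : 0 < m)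
    (hrow : ∀ X : n → ℝ, (X = U₀₀ ∨ X = U₁₀ ∨ X = U₀₁ ∨ X = U₁₁) →
      ∀ i, ∑ j ∈ univ.filter (fun j => dist i j ≠ 0), |K X i j| ≤ h)
    (hcol : ∀ X : n → ℝ, (X = U₀₀ ∨ X = U₁₀ ∨ X = U₀₁ ∨ X = U₁₁) →
      ∀ j, ∑ i ∈ univ.filter (fun i => dist i j ≠ 0), |K X i j| ≤ h)
    (hfloor : ∀ X : n → ℝ, (X = U₀₀ ∨ X = U₁₀ ∨ X = U₀₁ ∨ X = U₁₁) →
      ∀ v : n → ℝ, m * ∑ i, (v i) ^ 2 ≤ ∑ i, v i * (K X *ᵥ v) i)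
    (hη' : h * (Real.exp θ - 1) ≤ m / 2)
    {η : ℝ} (hη : ∑ x, ∑ y, |H U₀₀ x y| ≤ η) :
    |((K U₁₁)⁻¹ * H U₁₁).trace - ((K U₁₀)⁻¹ * H U₁₀).trace - ((K U₀₁)⁻¹ * H U₀₁).trace + ((K U₀₀)⁻¹ * H U₀₀).trace| ≤
      (((2 / m) * (LH * V * μ + LH₂ * V ^ 2 * δ ^ 2) + (2 / m) ^ 2 * η * (LK * V * μ + LK₂ * V ^ 2 * δ ^ 2)) *
            Real.exp (2 * θ) * V * Sloc +
          2 * (2 / m) ^ 2 * Sloc * Sdist * LK * (LH + (2 / m) * η * LK) * (V ^ 2 * Real.exp (2 * θ) * δ) ^ 2) *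
        s * t * Real.exp (-((θ - θ₂) * R)) := by
  have hθ : 0 ≤ θ := hθ₂.trans hθ₂θ
  -- Combes–Thomas at each corner
  have ct : ∀ X : n → ℝ, (X = U₀₀ ∨ X = U₁₀ ∨ X = U₀₁ ∨ X = U₁₁) →
      (K X).det ≠ 0 ∧ ∀ a b, |(K X)⁻¹ a b| ≤ 2 / m * Real.exp (-(θ * dist a b)) := by
    intro X hX
    obtain ⟨hdet, hA⟩ := coercive_combes_thomas_real dist hd0 hds hdt (K X) (hKr X) h (hrow X hX) (hcol X hX) m θ hm hθ
      (sq_floor_of_quadratic_floor (K X) hm (hfloor X hX)) hη'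
    exact ⟨hdet.ne_zero, hA⟩
  obtain ⟨h₀₀, hA₀₀⟩ := ct U₀₀ (Or.inl rfl)
  obtain ⟨h₁₀, hA₁₀⟩ := ct U₁₀ (Or.inr (Or.inl rfl))
  obtain ⟨h₀₁, hA₀₁⟩ := ct U₀₁ (Or.inr (Or.inr (Or.inl rfl)))
  obtain ⟨h₁₁, hA₁₁⟩ := ct U₁₁ (Or.inr (Or.inr (Or.inr rfl)))
  have main := abs_fourPt_trace_inv_mul_le_of_localMaps dist hds hLK hLK₂ hLH hLH₂ hKloc hKloc₂ hHloc hHloc₂ hKr hHr hV hθ₂ hθ₂θ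
    hd hd' hsep hsep₂ hSd hSd' hSdi hSdist0 hδ hμ hs ht hD10 hD11 hD01 hD11' hDD h₀₀ h₁₀ h₀₁ h₁₁ (by positivity : (0:ℝ) ≤ 2 / m)
    hA₀₀ hA₁₀ hA₀₁ hA₁₁ hη
  simpa only [Nat.cast_one, mul_one] using main

end Literature.Analysis.Matrix

end
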